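import Summits.HodgeConjecture.HodgeConjecture.Theorems.PadicSemiregularLiftHodgeFermatVarietiesPairedOfLargePrimesSharp
import Literature.AlgebraicGeometry.HodgeTheory.FermatClaimPairedCancellation
import Literature.AlgebraicGeometry.HodgeTheory.FermatClaimShiodaSpine
import HarnessLib

/-!
# Short Hodge multisets of a level with large prime factors are sums of pairs (stub S12 of line `cancel-by-any-claim-lattice`)

Crux `HodgeFermatVarieties` (stmt-HodgeConjecture-1334), line `cancel-by-any-claim-lattice`, stub S12
`stub_reachOfLargePrimes`: the MULTISET form of the landed character-form theorem
`PairedNull.isPaired_of_primeFactors_gt_sharp` (Aoki 1983 Thm. A, direction `𝔅ⁿₘ = 𝔇ⁿₘ` under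
`p > n + 1` for all primes `p ∣ m`). A non-empty Hodge multiset `s` of `ℤ/M` with `#s < p` for every
prime `p ∣ M` is realised as a Hodge character `α : Fin (2t+2) → ℤ/M`
(`IsHodgeMultiset.exists_isHodge_even`), which is paired by the sharp theorem, hence
`∼ (a₀, …, a_t, -a₀, …, -a_t)` (`IsPaired.exists_pairs`, `univ_val_map_pairs`); so
`s = Σₖ {aₖ, -aₖ}` is ℤ-reachable from the printed supply with `P` the pairs `{aₖ, -aₖ}` (all `aₖ ≠ 0`,
being entries of `s`) and `N = 0`. Everything is proved (no `sorry`).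

References: [Aoki1983] N. Aoki, On some arithmetic problems related to the Hodge cycles on the Fermat
varieties, Math. Ann. 266 (1983) 23–54, Thm. A.
-/

set_option linter.dupNamespace false

noncomputable section

open Finset
open Literature.AlgebraicGeometry.HodgeTheory Literature.AlgebraicGeometry.HodgeTheory.FermatCharacter

namespace Summit.HodgeConjecture.HodgeConjecture.Theorems.CancelByAnyClaimLattice.ReachOfLargePrimes

/-- `Supply[M]` — the printed supply of level `M` (local notation of the line, verbatim). -/
local notation3 (prettyPrint := false) "Supply[" M "]" =>
  ({s : Multiset (ZMod M) | ∃ a : ZMod M, a ≠ 0 ∧ s = ({a, -a} : Multiset (ZMod M))} ∪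
    {s : Multiset (ZMod M) | IsHodgeMultiset s ∧ Multiset.card s = 4} ∪
    {s : Multiset (ZMod M) | IsHodgeMultiset s ∧ IsSemiDecomposable s} ∪
    {s : Multiset (ZMod M) | ∃ (p : ℕ) (a : ZMod M), p.Prime ∧ p ≠ 2 ∧ p ∣ M ∧
        2 < (M / p) / Nat.gcd (ZMod.val a) (M / p) ∧
        s = Multiset.map (fun j : ℕ => a + (j : ZMod M) * ((M / p : ℕ) : ZMod M)) (Multiset.range p) +
              {-((p : ZMod M) * a)}} : Set (Multiset (ZMod M)))

/-- `Reach[M, s]` (local notation of the line, verbatim). -/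
local notation3 (prettyPrint := false) "Reach[" M ", " s "]" =>
  ∃ P N : Multiset (Multiset (ZMod M)),
    (∀ u ∈ P, u ∈ Supply[M]) ∧ (∀ u ∈ N, u ∈ Supply[M]) ∧ s + Multiset.sum N = Multiset.sum P

/-- The sum of the pairs `{a, -a}` over `a ∈ Q` is `Q` plus the multiset of negatives of `Q`. [folklore] -/
theorem sum_map_pair {M : ℕ} (Q : Multiset (ZMod M)) :
    (Q.map fun a ↦ ({a, -a} : Multiset (ZMod M))).sum = Q + Q.map (fun a ↦ -a) := by
  induction Q using Multiset.induction_on with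
  | empty => simp
  | cons a Q ih =>
    simp only [Multiset.map_cons, Multiset.sum_cons]
    rw [ih, Multiset.insert_eq_cons, Multiset.cons_add, Multiset.cons_add, Multiset.singleton_add,
      Multiset.add_cons]

/-- **S12: a non-empty Hodge multiset `s` of `ℤ/M` with `#s < p` for every prime `p ∣ M` is a sum of
pairs `{a, -a}`, `a ≠ 0`**, hence ℤ-reachable from the printed supply (`P` = the pairs, `N = 0`) — the
multiset form of `PairedNull.isPaired_of_primeFactors_gt_sharp` (Aoki 1983 Thm. A, `𝔅ⁿₘ = 𝔇ⁿₘ` for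
`p > n + 1`). [cite: Aoki1983, Thm. A] -/
theorem stub_reachOfLargePrimes :
    ∀ (M : ℕ) [NeZero M] (s : Multiset (ZMod M)), s ≠ 0 → IsHodgeMultiset s →
      (∀ p ∈ M.primeFactors, Multiset.card s < p) → Reach[M, s] := by
  intro M _ s hs0 hs hP
  classical
  -- realise `s` as a Hodge character of some `X²ᵗ_M`
  obtain ⟨t, α, hα, hαs⟩ := hs.exists_isHodge_even hs0
  have hc : Multiset.card s = 2 * t + 2 := card_eq_of_univ_val_map_eq hαs
  have hR : ∀ p ∈ M.primeFactors, 2 * t + 2 < p := fun p hp ↦ hc.symm.trans_lt (hP p hp)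
  -- the character is paired (Aoki 1983 Thm. A, sharp form), hence `∼ (a, -a)`
  obtain ⟨a, ha⟩ := (PairedNull.isPaired_of_primeFactors_gt_sharp hα hR).exists_pairs
  have hsQ : s = univ.val.map a + (univ.val.map a).map (fun x ↦ -x) := by
    rw [← hαs, ha, univ_val_map_pairs, Multiset.map_map]
    rfl
  refine ⟨(univ.val.map a).map fun x ↦ ({x, -x} : Multiset (ZMod M)), 0, fun u hu ↦ ?_,
    fun u hu ↦ absurd hu (Multiset.notMem_zero u), ?_⟩
  · obtain ⟨x, hx, rfl⟩ := Multiset.mem_map.1 hu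
    have hxs : x ∈ s := by rw [hsQ]; exact Multiset.mem_add.2 (Or.inl hx)
    exact Or.inl (Or.inl (Or.inl ⟨x, hs.1.1 x hxs, rfl⟩))
  · rw [Multiset.sum_zero, add_zero, sum_map_pair]
    exact hsQ

end Summit.HodgeConjecture.HodgeConjecture.Theorems.CancelByAnyClaimLattice.ReachOfLargePrimes

end
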